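import Summits.QuantumFields.BalabanUV.Beta.GAN24.StaircaseAveragingDefect
import Literature.MathematicalPhysics.QuantumFieldTheory.Balaban1983to89.B5Identities197Torus

/-!
# G-an2-4 ∕ (CONV-C), road P2, route R2-S1, VECTOR LAYER, PART 3 — THE VECTOR UNIT-LATTICE CONSTITUENT `c_n(a) := Q_n·𝒢_n(a)·Q_n*`
# (Bałaban's averaged propagator `QGQ*`, `𝒢 = Δ_a⁻¹` (1.69)–(1.71)) HAS AN EXACT TWO-LEVEL IDENTITY WITH ONLY LOCAL DEFECTS:
# the non-local gauge projection `P` of `Δ_a = Δ − ∂P∂* + aQ*Q` DROPS OUT by the printed gauge identities (1.95) `QG∂R = 0`, `R∂*GQ* = 0`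

Unit `b2b-balaban-gan24-p2` (gen 30), BINDER row G-an2-4 ∕ (CONV-C), road P2; crux team (2).  Road P2's scalar prototype (gens 28–29, the
G-an2-4 swarm) has the unit-lattice operator `S_n = a′Q′G′_nQ′*` with its one-step laws in both currencies, UNCONDITIONAL on cubic tori.  The
VECTOR constituent — Bałaban's `Q_k G_k Q_k*` ([Balaban1984PropagatorsI] (1.99), [Balaban1984PropagatorsII] (2.35): the denominator of the
hard minimiser `H_k = GQ*(QGQ*)⁻¹` and, inverted and shifted by `a`, the effective operator `Δ_k` (1.65); NE2's `covB` up to `n^d`) — involves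
`𝒢 = Δ_a⁻¹` whose generator contains the NON-LOCAL projection `P = Δ⁻¹Q′*(Q′Δ⁻²Q′*)⁻¹Q′Δ⁻¹` (1.70), so the resolvent identity
`𝒢′J − J𝒢 = −𝒢′(Δ′_aJ − JΔ_a)𝒢` has a defect `Δ′_aJ − JΔ_a` with a non-local, infrared-sensitive piece `∂′P′∂′ᴴJ − J∂P∂ᴴ`.  THIS FILE shows
that FOR THE UNIT-LATTICE SANDWICH that piece VANISHES IDENTICALLY, by the tree's kernel-checked (1.95) for the concrete torus operators
(`B5Identities197Torus.eq195_left ∕ eq195_right`, lit-balaban p21; `RT = 1 − PcT − Pker`, `∂·RT = ∂·(1 − PcT)`):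
 * §1 **`covOp n M a := QvOp n M * (DeltaA n M a)⁻¹ * QvAdj n M`** (`= Q𝒢Q*`); **`locOp n M a := Lap − ∂∂ᴴ + a•Q*Q`** — the LOCAL part of `Δ_a`
   (`curlᴴcurl + aQ*Q`, finite range); **`DeltaA_eq_locOp_add`**: `Δ_a = locOp + ∂·RT·∂ᴴ`;
 * §2 **`resolvent_stairV`**: `𝒢′·(J⊗1) − (J⊗1)·𝒢 = −𝒢′·(Δ′_a(J⊗1) − (J⊗1)Δ_a)·𝒢` (every `N, R ≥ 1`, `a > 0`, every torus);
 * §3 **`gauge_collapse`**: `Q′𝒢′·(Δ′_a(J⊗1) − (J⊗1)Δ_a)·𝒢Q* = Q′𝒢′·(locOp′(J⊗1) − (J⊗1)locOp)·𝒢Q*` — (1.95) twice;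
 * §4 **`covOp_succ_sub`** — THE IDENTITY: with `E₁ = fwdDefect`, `E₂ = adjDefect` (Part 2),
   `c_{RN} − c_N = Q′𝒢′E₂ + E₁𝒢Q* − Q′𝒢′·(locOp′(J⊗1) − (J⊗1)locOp)·𝒢Q*`, and **`locOp_stairV_defect`**:
   `locOp′(J⊗1) − (J⊗1)locOp = (Lap′(J⊗1) − (J⊗1)Lap) − (∂′∂′ᴴ(J⊗1) − (J⊗1)∂∂ᴴ) + a•(E₂Q + Q′*E₁)` — every term a finite-range stencil with an
   `O((R−1)∕(RN))` profile whose pointwise form is in the tree (`StaircaseLaplacianDefectVec.Lap_stairV_defect`,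
   `StaircaseGradDivDefect.GradOp_stair_defect ∕ GradOpH_stairV_defect`, Part 2).
CONSEQUENCE (next file, `AveragedPropagatorOneStepSup`): the one-step sup law of `c_n` follows from the five VECTOR sup letters of `𝒢` alone
(zeroth, `∇𝒢`, `𝒢∇ᴴ`, `∇∇𝒢`, `𝒢∇ᴴ∇ᴴ`) — all in the tree at `a = 1` on cubic tori — with NO letter for `P`, `Δ⁻¹`, `Δ⁻²` or `(Q′Δ⁻²Q′*)⁻¹`.
LIMIT OF THE TRICK (honest): it needs `Q′` on the left AND `Q*` on the right at the FULL averaging level; the fine constituents `H_k`,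
`G_k(1)` read at fine sites or through a one-step average `Q_R` do NOT collapse (`Q_R𝒢′∂′RT′ ≠ 0`).
HONEST SCOPE.  Exact finite-lattice operator algebra at `U = 1`, every `d`, `N, R ≥ 1`, every torus `M`, every `a > 0`; [folklore] over the
tree's (1.95) BY NAME; kernel-checked, no `sorry`, no `def … : Prop`.  [Balaban1984PropagatorsI] (1.69)–(1.71), (1.95), (1.99) are TEXT LOCATIONS
for the objects.  NOT (CONV-C) as typed, NEVER «G-an2-4 closed», NOT NE2, NOT D1, NOT BetaPertH, NOT continuum, NOT Clay; not in print — our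
proof.  HONEST DEPENDENCY: continuum YM on T⁴ ⇐ BetaPertH ∧ nine spine estimates (0/9 proved); BetaPertH ⇐ (D1) ∧ (D4) ∧ CAP+tail; G-an2-4
gates asym, D1 and NE2/3/4.
-/

noncomputable section

open scoped BigOperators ComplexConjugate Matrix

namespace Summit.QuantumFields.BalabanUV.Beta.GAN24.AveragedPropagatorTwoLevel

open Literature.MathematicalPhysics.QuantumFieldTheory.Balaban1983to89
open B5Prop11Plancherel (Tor fine)
open B5Prop11Lower (Lap)
open B5Action121 (GradOp)
open B5Block118 (QvOp)
open B5DeltaA169 (DeltaA QvAdj isUnit_DeltaA)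
open B5Identities197Torus (RT GradOp_mul_RT eq195_left eq195_right)
open Summit.QuantumFields.BalabanUV.Beta.GAN24.StaircaseAveragingDefect (stairV fwdDefect adjDefect Pi_stairV_defect)

variable {d : ℕ}

/-! ## §1 The objects -/

section OneLevel

variable (n : ℕ) [NeZero n] (M : Fin d → ℕ) [hM : ∀ μ, NeZero (M μ)] (a : ℝ)

/-- **the averaged propagator** `c_n(a) := Q_n·𝒢_n(a)·Q_n*` on unit-lattice bond fields (`𝒢 = Δ_a⁻¹`, `Q* = n^d·Qᴴ`). [folklore] -/
def covOp : Matrix (Tor M × Fin d) (Tor M × Fin d) ℂ := QvOp n M * (DeltaA n M a)⁻¹ * QvAdj n M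

/-- **the LOCAL part of `Δ_a`**: `locOp := Δ − ∂∂ᴴ + a•Q*Q` (`= ∂*∂ + aQ*Q` on vector fields, `∂*∂ = curlᴴcurl`; finite range). [folklore] -/
def locOp : Matrix (Tor (fine n M) × Fin d) (Tor (fine n M) × Fin d) ℂ :=
  Lap n M - GradOp (fine n M) (n : ℂ) * (GradOp (fine n M) (n : ℂ))ᴴ + (a : ℂ) • (QvAdj n M * QvOp n M)

/-- **`Δ_a = locOp + ∂·RT·∂ᴴ`** (`∂·P·∂ᴴ = ∂∂ᴴ − ∂·RT·∂ᴴ` since `∂·RT = ∂·(1 − PcT)`, `B5Identities197Torus.GradOp_mul_RT`). [folklore] -/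
theorem DeltaA_eq_locOp_add :
    DeltaA n M a = locOp n M a + GradOp (fine n M) (n : ℂ) * RT n M * (GradOp (fine n M) (n : ℂ))ᴴ := by
  rw [GradOp_mul_RT, DeltaA, locOp, Matrix.mul_sub, Matrix.mul_one, Matrix.sub_mul]
  abel

end OneLevel

/-! ## §2 The resolvent identity against the componentwise staircase -/

section TwoLevel

variable (N R : ℕ) [NeZero N] [NeZero R] (M : Fin d → ℕ) [hM : ∀ μ, NeZero (M μ)] (a : ℝ)

/-- **`𝒢′·(J⊗1) − (J⊗1)·𝒢 = −𝒢′·(Δ′_a(J⊗1) − (J⊗1)Δ_a)·𝒢`** (`𝒢′Δ′_a = 1`, `Δ_a𝒢 = 1`). [folklore] -/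
theorem resolvent_stairV (ha : 0 < a) :
    (DeltaA (R * N) M a)⁻¹ * stairV N R M - stairV N R M * (DeltaA N M a)⁻¹
      = -((DeltaA (R * N) M a)⁻¹ * (DeltaA (R * N) M a * stairV N R M - stairV N R M * DeltaA N M a) * (DeltaA N M a)⁻¹) := by
  have hN : 1 ≤ N := Nat.one_le_iff_ne_zero.mpr (NeZero.ne N)
  have hRN : 1 ≤ R * N := Nat.one_le_iff_ne_zero.mpr (NeZero.ne (R * N))
  have h1 : (DeltaA (R * N) M a)⁻¹ * DeltaA (R * N) M a = 1 :=
    Matrix.nonsing_inv_mul _ ((Matrix.isUnit_iff_isUnit_det _).mp (isUnit_DeltaA (R * N) hRN M a ha))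
  have h2 : DeltaA N M a * (DeltaA N M a)⁻¹ = 1 :=
    Matrix.mul_nonsing_inv _ ((Matrix.isUnit_iff_isUnit_det _).mp (isUnit_DeltaA N hN M a ha))
  rw [Matrix.mul_sub, Matrix.sub_mul, ← Matrix.mul_assoc _ (DeltaA (R * N) M a), h1, Matrix.one_mul,
    Matrix.mul_assoc _ (stairV N R M * DeltaA N M a), Matrix.mul_assoc (stairV N R M), h2, Matrix.mul_one]
  abel

/-! ## §3 The gauge collapse -/

/-- **GAUGE COLLAPSE**: `Q′𝒢′·(Δ′_a(J⊗1) − (J⊗1)Δ_a)·𝒢Q* = Q′𝒢′·(locOp′(J⊗1) − (J⊗1)locOp)·𝒢Q*` — the `∂·RT·∂ᴴ` parts drop by (1.95):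
`Q′𝒢′∂′·RT′ = 0` (`eq195_right` at level `RN`) and `RT·∂ᴴ𝒢Q* = 0` (`eq195_left` at level `N`). [folklore] -/
theorem gauge_collapse (ha : 0 < a) :
    QvOp (R * N) M * (DeltaA (R * N) M a)⁻¹ * (DeltaA (R * N) M a * stairV N R M - stairV N R M * DeltaA N M a)
        * (DeltaA N M a)⁻¹ * QvAdj N M
      = QvOp (R * N) M * (DeltaA (R * N) M a)⁻¹ * (locOp (R * N) M a * stairV N R M - stairV N R M * locOp N M a)
        * (DeltaA N M a)⁻¹ * QvAdj N M := by
  have hN : 1 ≤ N := Nat.one_le_iff_ne_zero.mpr (NeZero.ne N)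
  have hRN : 1 ≤ R * N := Nat.one_le_iff_ne_zero.mpr (NeZero.ne (R * N))
  have hr := eq195_right (R * N) hRN M a ha   -- Q′ * 𝒢′ * ∂′ * RT′ = 0
  have hl := eq195_left N hN M a ha           -- RT * ∂ᴴ * 𝒢 * Q* = 0
  -- expand `Δ_a = locOp + ∂·RT·∂ᴴ` at both levels
  have e1 : DeltaA (R * N) M a * stairV N R M - stairV N R M * DeltaA N M a
      = (locOp (R * N) M a * stairV N R M - stairV N R M * locOp N M a)
        + (GradOp (fine (R * N) M) ((R * N : ℕ) : ℂ) * RT (R * N) M * (GradOp (fine (R * N) M) ((R * N : ℕ) : ℂ))ᴴ * stairV N R M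
            - stairV N R M * (GradOp (fine N M) ((N : ℕ) : ℂ) * RT N M * (GradOp (fine N M) ((N : ℕ) : ℂ))ᴴ)) := by
    rw [DeltaA_eq_locOp_add, DeltaA_eq_locOp_add]
    simp only [Matrix.add_mul, Matrix.mul_add]
    abel
  rw [e1, Matrix.mul_add, Matrix.add_mul, Matrix.add_mul]
  -- the two `RT` terms vanish
  have t1 : QvOp (R * N) M * (DeltaA (R * N) M a)⁻¹
      * (GradOp (fine (R * N) M) ((R * N : ℕ) : ℂ) * RT (R * N) M * (GradOp (fine (R * N) M) ((R * N : ℕ) : ℂ))ᴴ * stairV N R M)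
      * (DeltaA N M a)⁻¹ * QvAdj N M = 0 := by
    have : QvOp (R * N) M * (DeltaA (R * N) M a)⁻¹
        * (GradOp (fine (R * N) M) ((R * N : ℕ) : ℂ) * RT (R * N) M * (GradOp (fine (R * N) M) ((R * N : ℕ) : ℂ))ᴴ * stairV N R M)
        = (QvOp (R * N) M * (DeltaA (R * N) M a)⁻¹ * GradOp (fine (R * N) M) ((R * N : ℕ) : ℂ) * RT (R * N) M)
          * ((GradOp (fine (R * N) M) ((R * N : ℕ) : ℂ))ᴴ * stairV N R M) := by
      simp only [Matrix.mul_assoc]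
    rw [this, hr, Matrix.zero_mul, Matrix.zero_mul, Matrix.zero_mul]
  have t2 : QvOp (R * N) M * (DeltaA (R * N) M a)⁻¹
      * (stairV N R M * (GradOp (fine N M) ((N : ℕ) : ℂ) * RT N M * (GradOp (fine N M) ((N : ℕ) : ℂ))ᴴ))
      * (DeltaA N M a)⁻¹ * QvAdj N M = 0 := by
    have : QvOp (R * N) M * (DeltaA (R * N) M a)⁻¹
        * (stairV N R M * (GradOp (fine N M) ((N : ℕ) : ℂ) * RT N M * (GradOp (fine N M) ((N : ℕ) : ℂ))ᴴ))
        * (DeltaA N M a)⁻¹ * QvAdj N M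
        = (QvOp (R * N) M * (DeltaA (R * N) M a)⁻¹ * stairV N R M * GradOp (fine N M) ((N : ℕ) : ℂ))
          * (RT N M * (GradOp (fine N M) ((N : ℕ) : ℂ))ᴴ * (DeltaA N M a)⁻¹ * QvAdj N M) := by
      simp only [Matrix.mul_assoc]
    rw [this, hl, Matrix.mul_zero]
  have t12 : QvOp (R * N) M * (DeltaA (R * N) M a)⁻¹
      * (GradOp (fine (R * N) M) ((R * N : ℕ) : ℂ) * RT (R * N) M * (GradOp (fine (R * N) M) ((R * N : ℕ) : ℂ))ᴴ * stairV N R M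
          - stairV N R M * (GradOp (fine N M) ((N : ℕ) : ℂ) * RT N M * (GradOp (fine N M) ((N : ℕ) : ℂ))ᴴ))
      * (DeltaA N M a)⁻¹ * QvAdj N M = 0 := by
    rw [Matrix.mul_sub, Matrix.sub_mul, Matrix.sub_mul, t1, t2, sub_zero]
  rw [t12, add_zero]

/-! ## §4 The two-level identity of the averaged propagator -/

/-- **THE LOCAL DEFECT OF `Δ_a`'s LOCAL PART, SPLIT**: `locOp′(J⊗1) − (J⊗1)locOp = (Lap′(J⊗1) − (J⊗1)Lap) − (∂′∂′ᴴ(J⊗1) − (J⊗1)∂∂ᴴ)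
+ a•(E₂·Q + Q′*·E₁)` (Part 2's `Pi_stairV_defect` for the mass term). [folklore] -/
theorem locOp_stairV_defect :
    locOp (R * N) M a * stairV N R M - stairV N R M * locOp N M a
      = (Lap (R * N) M * stairV N R M - stairV N R M * Lap N M)
        - (GradOp (fine (R * N) M) ((R * N : ℕ) : ℂ) * (GradOp (fine (R * N) M) ((R * N : ℕ) : ℂ))ᴴ * stairV N R M
            - stairV N R M * (GradOp (fine N M) ((N : ℕ) : ℂ) * (GradOp (fine N M) ((N : ℕ) : ℂ))ᴴ))
        + (a : ℂ) • (adjDefect N R M * QvOp N M + QvAdj (R * N) M * fwdDefect N R M) := by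
  rw [← Pi_stairV_defect, locOp, locOp]
  simp only [Matrix.sub_mul, Matrix.mul_sub, Matrix.add_mul, Matrix.mul_add, Matrix.smul_mul, Matrix.mul_smul, smul_sub,
    Matrix.mul_assoc]
  abel

/-- **THE TWO-LEVEL IDENTITY OF THE AVERAGED PROPAGATOR, EXACTLY**: for every `N, R ≥ 1`, every torus, every `a > 0`,
`c_{RN}(a) − c_N(a) = Q′𝒢′·E₂ + E₁·𝒢Q* − Q′𝒢′·(locOp′(J⊗1) − (J⊗1)locOp)·𝒢Q*` with `E₁ = Q′(J⊗1) − Q` (forward averaging defect),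
`E₂ = Q′* − (J⊗1)Q*` (adjoint averaging defect), `locOp = Δ − ∂∂ᴴ + aQ*Q` — NO `P`, NO `Δ⁻¹`: every defect on the right is a finite-range
stencil with an `O((R−1)∕(RN))` profile. [folklore] -/
theorem covOp_succ_sub (ha : 0 < a) :
    covOp (R * N) M a - covOp N M a
      = QvOp (R * N) M * (DeltaA (R * N) M a)⁻¹ * adjDefect N R M
        + fwdDefect N R M * (DeltaA N M a)⁻¹ * QvAdj N M
        - QvOp (R * N) M * (DeltaA (R * N) M a)⁻¹ * (locOp (R * N) M a * stairV N R M - stairV N R M * locOp N M a)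
            * (DeltaA N M a)⁻¹ * QvAdj N M := by
  rw [← gauge_collapse N R M a ha]
  have hres := resolvent_stairV N R M a ha
  set G' := (DeltaA (R * N) M a)⁻¹
  set G := (DeltaA N M a)⁻¹
  set J := stairV N R M
  -- `Q′* = E₂ + J Q*`, `Q = Q′J − E₁`
  have hE2 : QvAdj (R * N) M = adjDefect N R M + J * QvAdj N M := by rw [adjDefect]; abel
  have hE1 : QvOp N M = QvOp (R * N) M * J - fwdDefect N R M := by rw [fwdDefect]; abel
  -- `Q′(𝒢′J − J𝒢)Q* = −Q′𝒢′D𝒢Q*`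
  have hmid : QvOp (R * N) M * (G' * J - J * G) * QvAdj N M
      = -(QvOp (R * N) M * G' * (DeltaA (R * N) M a * J - J * DeltaA N M a) * G * QvAdj N M) := by
    rw [hres]; simp only [Matrix.mul_neg, Matrix.neg_mul, Matrix.mul_assoc]
  calc covOp (R * N) M a - covOp N M a
      = QvOp (R * N) M * G' * QvAdj (R * N) M - QvOp N M * G * QvAdj N M := by rw [covOp, covOp]
    _ = QvOp (R * N) M * G' * (adjDefect N R M + J * QvAdj N M) - (QvOp (R * N) M * J - fwdDefect N R M) * G * QvAdj N M := by
        rw [← hE2, ← hE1]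
    _ = QvOp (R * N) M * G' * adjDefect N R M + fwdDefect N R M * G * QvAdj N M
          + QvOp (R * N) M * (G' * J - J * G) * QvAdj N M := by
        simp only [Matrix.mul_add, Matrix.sub_mul, Matrix.mul_sub, Matrix.mul_assoc]; abel
    _ = _ := by rw [hmid]; abel

end TwoLevel

end Summit.QuantumFields.BalabanUV.Beta.GAN24.AveragedPropagatorTwoLevel

end
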